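import Summits.CriticalPhenomena.PercolationContinuityZ3.Theorems.PercNearOneGluingNoHeavyQuantCherryCombRow
import HarnessLib

/-!
# QUANT lane R8, FAR on trees beyond block-combs: the LIGHT-HAIR MIXTURE STEP in the stemmed canonical model — a two-class hair whose mean
# does not exceed its top class (`s(p + cr) ≤ p`) is a mean-preserving mixture of its top block re-gated and of the whole hair glued

builds on p205010 (kernel theorem, internal audit signed; external expert review pending)

Support file (`--supports stmt-CriticalPhenomena-4575`), QUANT lane seat prim-quant-p1 (gen 10); memo `run/shared/lean/prim/quant/P1-SURPLUS.md` §21.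
Theorems only (local notation of `…QuantCherryCombModels`, no definitions), no sorries, standard axioms.  Companion of `…QuantCherryCombMixture`
(the unit-cherry step); both steps feed the induction of `…QuantHairCherryCombRow.lean` (same seat).

**The hair in the stemmed model.**  A stem `s₀` (`st s₀ = s₀`) of size `p > 0` and gate `s` with exactly ONE leaf `ℓ` (`st ℓ = s₀`) of size `r`
and gate `c` at the stem's level: the relay count `p·ζ_{s₀} + r·ζ_{s₀}ζ_ℓ` of a class of `p` relays hung at the chain by the gate `s` with a further
class of `r` relays one private path (`c`) below it.  Its law `H = (1−s)δ₀ + s(1−c)δ_p + scδ_{p+r}` has mean `s(p + cr)`; when the hair is LIGHT,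
`s(p + cr) ≤ p`, the two blob laws `A = Block_p(g_A)`, `g_A = s(p+cr)/p ≤ 1`, and `B = Block_{p+r}(g_B)`, `g_B = s(p+cr)/(p+r)`, have the same
mean, gates `≥ sc` (the hair's least conditional marginal), and `(p + cr)·H = p(1−c)·A + c(p+r)·B`.  (P1-SURPLUS §21.3: for `p ≠ r` these are the
ONLY blob laws supported in `{0, p, p+r}` with that mean, so a HEAVY hair with `p ≠ r` is outside the method; `p = r` is the unit cherry.)

* `Quant.CherryComb.two_split` — conditioning the product weight on two pieces (four terms).
* `Quant.CherryComb.inner_hair_eq` — the depth-`i` configuration sum of the hair model as `E_H` of the functional `h ↦ 𝟙[j+1 ≤ massSt_i t + h']`.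
* `Quant.CherryComb.inner_deadLeaf_eq` — the same for the model with the leaf deleted (`a ℓ := 0`, `st ℓ := ℓ`) and the stem re-sized to `P`
  and re-gated to `γ`: `γ·F_P + (1−γ)·F_0` (both `A`: `P = p, γ = g_A` and `B`: `P = p+r, γ = g_B`).
* `Quant.CherryComb.hair_mixture_identity` — `(p + cr)·E_H = p(1−c)·E_A + c(p+r)·E_B` (from `g_A·p = s(p+cr) = g_B·(p+r)`).
* `Quant.CherryComb.min_tail_top_glue_le_tail` — **THE LIGHT-HAIR MIXTURE STEP**: `min(TAILst A, TAILst B) ≤ TAILst H`.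
[this work]; product weights [cite: Grimmett1999, §1.3 p. 10].
-/

namespace Summit.CriticalPhenomena.PercolationContinuityZ3.Theorems

namespace Quant

namespace CherryComb

open Finset

variable {κ : Type*} [Fintype κ] [DecidableEq κ]

/-- product-Bernoulli weight of the set `S` of open pieces -/
local notation3 "wt[" g ", " S "]" => ∏ k, (if k ∈ (S : Finset κ) then (g : κ → ℝ) k else 1 - (g : κ → ℝ) k)

/-- product weight of `t` relative to the finset `U` of pieces -/
local notation3 "pw[" U ", " g ", " t "]" =>
  ∏ k ∈ (U : Finset κ), (if k ∈ (t : Finset κ) then (g : κ → ℝ) k else 1 - (g : κ → ℝ) k)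

/-- probability that the chain `q` of length `D` is open exactly to depth `i` -/
local notation3 "pd[" D ", " q ", " i "]" =>
  (∏ i' ∈ Finset.range (i : ℕ), (q : ℕ → ℝ) i') * (if (i : ℕ) < (D : ℕ) then 1 - (q : ℕ → ℝ) i else 1)

/-- mass counted at depth `i` in configuration `S` of the STEMMED model -/
local notation3 "massSt[" lv ", " a ", " st ", " i ", " S "]" =>
  ∑ k ∈ (S : Finset κ).filter (fun k => (lv : κ → ℕ) k ≤ (i : ℕ) ∧ (st : κ → κ) k ∈ (S : Finset κ)), ((a : κ → ℕ) k : ℕ)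

/-- the stemmed tail `P(N ≥ j+1)` -/
local notation3 "TAILst[" D ", " q ", " lv ", " a ", " g ", " st ", " j "]" =>
  ∑ i ∈ Finset.range ((D : ℕ) + 1), pd[D, q, i] *
    ∑ S : Finset κ, wt[g, S] * (if (j : ℕ) + 1 ≤ massSt[lv, a, st, i, S] then (1 : ℝ) else 0)

/-! ### 1. Conditioning on two pieces -/

/-- **Two-piece split.**  For distinct pieces `ℓ, s₀` and `U = κ ∖ {ℓ, s₀}`:
`Σ_S wt S · Φ S = Σ_{t ⊆ U} pw_U t · [four terms]`. [folklore] -/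
theorem two_split (g : κ → ℝ) (ℓ s₀ : κ) (h1 : s₀ ≠ ℓ) (Φ : Finset κ → ℝ) :
    ∑ S : Finset κ, wt[g, S] * Φ S =
      ∑ t ∈ ((Finset.univ.erase ℓ).erase s₀).powerset, pw[(Finset.univ.erase ℓ).erase s₀, g, t] *
        (g ℓ * (g s₀ * Φ (insert ℓ (insert s₀ t)) + (1 - g s₀) * Φ (insert ℓ t)) +
          (1 - g ℓ) * (g s₀ * Φ (insert s₀ t) + (1 - g s₀) * Φ t)) := by
  have hL : (∑ S : Finset κ, wt[g, S] * Φ S) = ∑ S ∈ (Finset.univ : Finset κ).powerset, pw[Finset.univ, g, S] * Φ S := by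
    rw [Finset.powerset_univ]
  rw [hL]
  have m1 : ℓ ∈ (Finset.univ : Finset κ) := Finset.mem_univ _
  have m2 : s₀ ∈ (Finset.univ : Finset κ).erase ℓ := Finset.mem_erase.2 ⟨h1, Finset.mem_univ _⟩
  rw [IndepBlob.sum_weight_powerset_split g _ m1 Φ,
    IndepBlob.sum_weight_powerset_split g _ m2 (fun t => Φ (insert ℓ t)),
    IndepBlob.sum_weight_powerset_split g _ m2 Φ]
  simp only [Finset.mul_sum, ← Finset.sum_add_distrib]
  exact Finset.sum_congr rfl fun t _ => by ring

/-! ### 2. The hair and the dead-leaf models, conditioned on the rest -/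

section Hair

variable (lv : κ → ℕ) (a : κ → ℕ) (g : κ → ℝ) (st : κ → κ) (s₀ ℓ : κ) (p r : ℕ)

/-- **Model `H` (the hair).**  Stem `s₀` (`st s₀ = s₀`) of size `p` with exactly one leaf `ℓ ≠ s₀` of size `r` at the stem's level (the fibre of `st`
over `s₀` is `{s₀, ℓ}`, `ℓ` itself no stem): the depth-`i` configuration sum is `E_H` of `h ↦ 𝟙[j+1 ≤ massSt_i t + h·𝟙[lv s₀ ≤ i]]`, `E_H` the
expectation under `(1−s)δ₀ + s(1−c)δ_p + scδ_{p+r}`, against the product weight of the other pieces. [this work] -/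
theorem inner_hair_eq (h1 : s₀ ≠ ℓ) (hst0 : st s₀ = s₀) (hst1 : st ℓ = s₀) (hfib : ∀ k, st k = s₀ → k = s₀ ∨ k = ℓ)
    (hnl : ∀ k, st k ≠ ℓ) (ha0 : a s₀ = p) (ha1 : a ℓ = r) (hlv1 : lv ℓ = lv s₀) (i j : ℕ) :
    ∑ S : Finset κ, wt[g, S] * (if j + 1 ≤ massSt[lv, a, st, i, S] then (1 : ℝ) else 0) =
      ∑ t ∈ ((Finset.univ.erase ℓ).erase s₀).powerset, pw[(Finset.univ.erase ℓ).erase s₀, g, t] *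
        (g s₀ * (g ℓ * (if j + 1 ≤ massSt[lv, a, st, i, t] + (if lv s₀ ≤ i then p + r else 0) then (1 : ℝ) else 0) +
            (1 - g ℓ) * (if j + 1 ≤ massSt[lv, a, st, i, t] + (if lv s₀ ≤ i then p else 0) then (1 : ℝ) else 0)) +
          (1 - g s₀) * (if j + 1 ≤ massSt[lv, a, st, i, t] then (1 : ℝ) else 0)) := by
  rw [two_split g ℓ s₀ h1]
  refine Finset.sum_congr rfl fun t ht => ?_
  rw [Finset.mem_powerset] at ht
  have hs₀t : s₀ ∉ t := fun h => by simpa using ht h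
  have hℓt : ℓ ∉ t := fun h => by have := ht h; simp [h1.symm] at this
  have hns₀ : ∀ k' ∈ t, st k' ≠ s₀ := by
    intro k' hk' hk's
    rcases hfib k' hk's with h | h
    · exact hs₀t (h ▸ hk')
    · exact hℓt (h ▸ hk')
  have e1 : massSt[lv, a, st, i, insert s₀ t] = massSt[lv, a, st, i, t] + (if lv s₀ ≤ i then p else 0) := by
    rw [massSt_insert_of_stem_mem lv a st i t s₀ hs₀t hns₀ (by rw [hst0]; simp), ha0]
  have e2 : massSt[lv, a, st, i, insert ℓ (insert s₀ t)] = massSt[lv, a, st, i, t] + (if lv s₀ ≤ i then p + r else 0) := by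
    rw [massSt_insert_of_stem_mem lv a st i _ ℓ (by simp [h1.symm, hℓt]) (fun k' _ => hnl k') (by rw [hst1]; simp), e1, hlv1, ha1]
    split_ifs <;> omega
  have e3 : massSt[lv, a, st, i, insert ℓ t] = massSt[lv, a, st, i, t] := by
    rw [massSt_insert_of_stem_notMem lv a st i t ℓ hℓt (fun k' _ => hnl k') (by rw [hst1]; simp [h1, hs₀t])]
  simp only [e1, e2, e3]
  ring

omit [Fintype κ] in
/-- Stem bookkeeping of the dead-leaf model `st ℓ := ℓ`. [this work] -/
theorem deadLeaf_facts (h1 : s₀ ≠ ℓ) (hst0 : st s₀ = s₀) (hfib : ∀ k, st k = s₀ → k = s₀ ∨ k = ℓ) (hnl : ∀ k, st k ≠ ℓ) :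
    Function.update st ℓ ℓ ℓ = ℓ ∧ Function.update st ℓ ℓ s₀ = s₀ ∧ (∀ k, k ≠ ℓ → Function.update st ℓ ℓ k = st k) ∧
      (∀ S : Finset κ, ℓ ∉ S → ∀ k' ∈ S, Function.update st ℓ ℓ k' ≠ ℓ) ∧
      (∀ t : Finset κ, ℓ ∉ t → s₀ ∉ t → ∀ k' ∈ t, Function.update st ℓ ℓ k' ≠ s₀) := by
  refine ⟨Function.update_self _ _ _, by rw [Function.update_of_ne h1, hst0], fun k hk => Function.update_of_ne hk _ _, ?_, ?_⟩
  · intro S hS k' hk' h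
    have hk' : k' ≠ ℓ := fun h' => hS (h' ▸ hk')
    rw [Function.update_of_ne hk'] at h
    exact hnl k' h
  · intro t hℓt hs₀t k' hk' h
    have hk'ℓ : k' ≠ ℓ := fun h' => hℓt (h' ▸ hk')
    rw [Function.update_of_ne hk'ℓ] at h
    rcases hfib k' h with h' | h'
    · exact hs₀t (h' ▸ hk')
    · exact hk'ℓ h'

/-- **The dead-leaf model.**  Same stem/leaf; in the model with the leaf deleted and detached (`a ℓ := 0`, `st ℓ := ℓ`) and the stem re-sized to `P`
and re-gated to `γ`, the depth-`i` configuration sum is `γ·F_P + (1−γ)·F_0`. [this work] -/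
theorem inner_deadLeaf_eq (h1 : s₀ ≠ ℓ) (hst0 : st s₀ = s₀) (hfib : ∀ k, st k = s₀ → k = s₀ ∨ k = ℓ) (hnl : ∀ k, st k ≠ ℓ)
    (P : ℕ) (γ : ℝ) (i j : ℕ) :
    ∑ S : Finset κ, wt[(Function.update g s₀ γ), S] *
        (if j + 1 ≤ massSt[lv, (Function.update (Function.update a s₀ P) ℓ 0), (Function.update st ℓ ℓ), i, S] then (1 : ℝ) else 0) =
      ∑ t ∈ ((Finset.univ.erase ℓ).erase s₀).powerset, pw[(Finset.univ.erase ℓ).erase s₀, g, t] *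
        (γ * (if j + 1 ≤ massSt[lv, a, st, i, t] + (if lv s₀ ≤ i then P else 0) then (1 : ℝ) else 0) +
          (1 - γ) * (if j + 1 ≤ massSt[lv, a, st, i, t] then (1 : ℝ) else 0)) := by
  obtain ⟨hstD1, hstD0, hstDo, hnD1, hnD0'⟩ := deadLeaf_facts st s₀ ℓ h1 hst0 hfib hnl
  set gD := Function.update g s₀ γ with hgD
  set aD := Function.update (Function.update a s₀ P) ℓ 0 with haD
  set stD := Function.update st ℓ ℓ with hstD
  have hgD0 : gD s₀ = γ := by rw [hgD, Function.update_self]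
  have hgDo : ∀ k, k ≠ s₀ → gD k = g k := fun k hk => by rw [hgD, Function.update_of_ne hk]
  have haD0 : aD s₀ = P := by rw [haD, Function.update_of_ne h1, Function.update_self]
  have haD1 : aD ℓ = 0 := by rw [haD, Function.update_self]
  have haDo : ∀ k, k ≠ ℓ → k ≠ s₀ → aD k = a k := fun k hk1 hk0 => by
    rw [haD, Function.update_of_ne hk1, Function.update_of_ne hk0]
  rw [two_split gD ℓ s₀ h1]
  refine Finset.sum_congr rfl fun t ht => ?_
  rw [Finset.mem_powerset] at ht
  have hs₀t : s₀ ∉ t := fun h => by simpa using ht h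
  have hℓt : ℓ ∉ t := fun h => by have := ht h; simp [h1.symm] at this
  have hU : ∀ k ∈ (Finset.univ.erase ℓ).erase s₀, gD k = g k := by
    intro k hk
    simp only [Finset.mem_erase, Finset.mem_univ, and_true] at hk
    exact hgDo k hk.1
  rw [pw_congr _ g gD hU t]
  have hnD0 := hnD0' t hℓt hs₀t
  have e0 : massSt[lv, aD, stD, i, t] = massSt[lv, a, st, i, t] :=
    massSt_congr lv a aD st stD i t (fun k hk => haDo k (fun h => hℓt (h ▸ hk)) (fun h => hs₀t (h ▸ hk)))
      fun k hk => hstDo k (fun h => hℓt (h ▸ hk))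
  have e1 : massSt[lv, aD, stD, i, insert s₀ t] = massSt[lv, a, st, i, t] + (if lv s₀ ≤ i then P else 0) := by
    rw [massSt_insert_of_stem_mem lv aD stD i t s₀ hs₀t hnD0 (by rw [hstD0]; simp), haD0, e0]
  have eℓ : ∀ S : Finset κ, ℓ ∉ S → massSt[lv, aD, stD, i, insert ℓ S] = massSt[lv, aD, stD, i, S] := by
    intro S hS
    rw [massSt_insert_of_stem_mem lv aD stD i S ℓ hS (hnD1 S hS) (by rw [hstD1]; simp), haD1, ite_self, add_zero]
  have e2 : massSt[lv, aD, stD, i, insert ℓ (insert s₀ t)] = massSt[lv, a, st, i, t] + (if lv s₀ ≤ i then P else 0) := by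
    rw [eℓ _ (by simp [h1.symm, hℓt]), e1]
  have e3 : massSt[lv, aD, stD, i, insert ℓ t] = massSt[lv, a, st, i, t] := by rw [eℓ _ hℓt, e0]
  simp only [e0, e1, e2, e3, hgD0, hgDo ℓ h1.symm]
  ring

end Hair

/-! ### 3. The light-hair mixture step -/

omit [Fintype κ] [DecidableEq κ] in
/-- **The hair identity.**  If `g_A·p = s(p + cr)` and `g_B·(p + r) = s(p + cr)` then
`(p + cr)·E_H = p(1−c)·E_A + c(p+r)·E_B` for every functional `(F₀, F_p, F_{p+r})`. [this work] -/
theorem hair_mixture_identity (s c gA gB p r F₀ Fp Fpr : ℝ) (hA : gA * p = s * (p + c * r)) (hB : gB * (p + r) = s * (p + c * r)) :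
    (p + c * r) * (s * (c * Fpr + (1 - c) * Fp) + (1 - s) * F₀) =
      p * (1 - c) * (gA * Fp + (1 - gA) * F₀) + c * (p + r) * (gB * Fpr + (1 - gB) * F₀) := by
  linear_combination (-((1 - c) * (Fp - F₀))) * hA - (c * (Fpr - F₀)) * hB

/-- **THE LIGHT-HAIR MIXTURE STEP.**  In the stemmed model, for a hair (stem `s₀` of size `p > 0` and gate `s`, one leaf `ℓ` of size `r` and gate
`c ∈ [0,1]` at the stem's level, fibre `{s₀, ℓ}`, `ℓ` no stem):
`min(TAILst A, TAILst B) ≤ TAILst H`, where `A` deletes the leaf and re-gates the stem to `g_A = s(p+cr)/p` and `B` deletes the leaf, re-sizes the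
stem to `p + r` and re-gates it to `g_B = s(p+cr)/(p+r)` (an identity-based step: lightness `s(p+cr) ≤ p` is needed only later, for `g_A ≤ 1`). [this work] -/
theorem min_tail_top_glue_le_tail (D : ℕ) (q : ℕ → ℝ) (lv : κ → ℕ) (a : κ → ℕ) (g : κ → ℝ) (st : κ → κ) (s₀ ℓ : κ) (p r : ℕ)
    (h1 : s₀ ≠ ℓ) (hst0 : st s₀ = s₀) (hst1 : st ℓ = s₀) (hfib : ∀ k, st k = s₀ → k = s₀ ∨ k = ℓ) (hnl : ∀ k, st k ≠ ℓ)
    (ha0 : a s₀ = p) (ha1 : a ℓ = r) (hlv1 : lv ℓ = lv s₀) (hp : 0 < p) (hg1 : 0 ≤ g ℓ ∧ g ℓ ≤ 1) (j : ℕ) :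
    min (TAILst[D, q, lv, (Function.update (Function.update a s₀ p) ℓ 0), (Function.update g s₀ (g s₀ * (p + g ℓ * r) / p)),
            (Function.update st ℓ ℓ), j])
        (TAILst[D, q, lv, (Function.update (Function.update a s₀ (p + r)) ℓ 0), (Function.update g s₀ (g s₀ * (p + g ℓ * r) / (p + r))),
            (Function.update st ℓ ℓ), j]) ≤
      TAILst[D, q, lv, a, g, st, j] := by
  have hp' : (0 : ℝ) < p := by exact_mod_cast hp
  have hpr : (0 : ℝ) < p + r := by positivity
  have hA : g s₀ * (p + g ℓ * r) / p * p = g s₀ * (p + g ℓ * r) := div_mul_cancel₀ _ hp'.ne'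
  have hB : g s₀ * (p + g ℓ * r) / (p + r) * (p + r) = g s₀ * (p + g ℓ * r) := div_mul_cancel₀ _ hpr.ne'
  -- per depth: the exact identity
  have key : ∀ i : ℕ,
      ((p : ℝ) + g ℓ * r) * (∑ S : Finset κ, wt[g, S] * (if j + 1 ≤ massSt[lv, a, st, i, S] then (1 : ℝ) else 0)) =
        p * (1 - g ℓ) *
            (∑ S : Finset κ, wt[(Function.update g s₀ (g s₀ * (p + g ℓ * r) / p)), S] *
              (if j + 1 ≤ massSt[lv, (Function.update (Function.update a s₀ p) ℓ 0), (Function.update st ℓ ℓ), i, S]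
                then (1 : ℝ) else 0)) +
          g ℓ * (p + r) *
            (∑ S : Finset κ, wt[(Function.update g s₀ (g s₀ * (p + g ℓ * r) / (p + r))), S] *
              (if j + 1 ≤ massSt[lv, (Function.update (Function.update a s₀ (p + r)) ℓ 0), (Function.update st ℓ ℓ), i, S]
                then (1 : ℝ) else 0)) := by
    intro i
    rw [inner_hair_eq lv a g st s₀ ℓ p r h1 hst0 hst1 hfib hnl ha0 ha1 hlv1 i j,
      inner_deadLeaf_eq lv a g st s₀ ℓ h1 hst0 hfib hnl p _ i j,
      inner_deadLeaf_eq lv a g st s₀ ℓ h1 hst0 hfib hnl (p + r) _ i j,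
      Finset.mul_sum, Finset.mul_sum, Finset.mul_sum, ← Finset.sum_add_distrib]
    refine Finset.sum_congr rfl fun t _ => ?_
    have hid := hair_mixture_identity (g s₀) (g ℓ) (g s₀ * (p + g ℓ * r) / p) (g s₀ * (p + g ℓ * r) / (p + r)) p r
      (if j + 1 ≤ massSt[lv, a, st, i, t] then (1 : ℝ) else 0)
      (if j + 1 ≤ massSt[lv, a, st, i, t] + (if lv s₀ ≤ i then p else 0) then (1 : ℝ) else 0)
      (if j + 1 ≤ massSt[lv, a, st, i, t] + (if lv s₀ ≤ i then p + r else 0) then (1 : ℝ) else 0) hA hB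
    linear_combination (pw[((Finset.univ.erase ℓ).erase s₀), g, t]) * hid
  have hI : ((p : ℝ) + g ℓ * r) * TAILst[D, q, lv, a, g, st, j] =
      p * (1 - g ℓ) * TAILst[D, q, lv, (Function.update (Function.update a s₀ p) ℓ 0),
          (Function.update g s₀ (g s₀ * (p + g ℓ * r) / p)), (Function.update st ℓ ℓ), j] +
        g ℓ * (p + r) * TAILst[D, q, lv, (Function.update (Function.update a s₀ (p + r)) ℓ 0),
          (Function.update g s₀ (g s₀ * (p + g ℓ * r) / (p + r))), (Function.update st ℓ ℓ), j] := by
    rw [Finset.mul_sum, Finset.mul_sum, Finset.mul_sum, ← Finset.sum_add_distrib]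
    refine Finset.sum_congr rfl fun i _ => ?_
    linear_combination (pd[D, q, i]) * key i
  have hc1 : 0 ≤ (p : ℝ) * (1 - g ℓ) := mul_nonneg hp'.le (sub_nonneg.2 hg1.2)
  have hc2 : 0 ≤ g ℓ * ((p : ℝ) + r) := mul_nonneg hg1.1 hpr.le
  have hcpos : 0 < (p : ℝ) + g ℓ * r := by
    have : 0 ≤ g ℓ * (r : ℝ) := mul_nonneg hg1.1 (by positivity)
    linarith
  refine le_of_mul_le_mul_left ?_ hcpos
  rw [hI]
  have h1' := mul_le_mul_of_nonneg_left (min_le_left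
    (TAILst[D, q, lv, (Function.update (Function.update a s₀ p) ℓ 0),
        (Function.update g s₀ (g s₀ * (p + g ℓ * r) / p)), (Function.update st ℓ ℓ), j])
    (TAILst[D, q, lv, (Function.update (Function.update a s₀ (p + r)) ℓ 0),
        (Function.update g s₀ (g s₀ * (p + g ℓ * r) / (p + r))), (Function.update st ℓ ℓ), j])) hc1
  have h2' := mul_le_mul_of_nonneg_left (min_le_right
    (TAILst[D, q, lv, (Function.update (Function.update a s₀ p) ℓ 0),
        (Function.update g s₀ (g s₀ * (p + g ℓ * r) / p)), (Function.update st ℓ ℓ), j])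
    (TAILst[D, q, lv, (Function.update (Function.update a s₀ (p + r)) ℓ 0),
        (Function.update g s₀ (g s₀ * (p + g ℓ * r) / (p + r))), (Function.update st ℓ ℓ), j])) hc2
  nlinarith [h1', h2']

end CherryComb

end Quant

end Summit.CriticalPhenomena.PercolationContinuityZ3.Theorems
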